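import Summits.CriticalPhenomena.PercolationContinuityZ3.Theorems.PercNearOneGluingNoHeavyLowerTailMixCSHHtwCore
import Summits.CriticalPhenomena.PercolationContinuityZ3.Theorems.PercNearOneGluingNoHeavyLowerTailCovTauMetaA2Anti
import Summits.CriticalPhenomena.PercolationContinuityZ3.Theorems.PercNearOneGluingNoHeavyLowerTailCovTauStarBridgeS
import HarnessLib

/-!
# Mixed conditioned slack hierarchy — A2 with a HUB for the covariance functional, modulo the two-set input only

Support file (`--supports stmt-CriticalPhenomena-4575`), prover `prim-ineq-gen-7` (gen 8).  No definitions, no named facts, no sorries.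
Memo `prim-ineq-gen-7/Q9-WRITEUP.md` Lemma 5.2 / Cor. 5.3; blueprint `PROOF-Q9-MIXED-CSH.md` §10 brick B4.

`CovTau.metaA2_mix_of_star` (p212674) is run — exactly as prim-hp-4's `CovTau.a2H` runs `CovTau.metaA2` — with the avoided set a marker set
`S ∋ x`, `v ∉ S`, and the world functional `F(U') = H_{G[U']}(v) = Cov_{G[U']}(g(C_x), 1{v ↔ S})` (`CovTau.BfS`); its one-source inputs
`(★^H)` / `Y^H ≤ H` are prim-ineq-prove-1's `CovTauStarN.yS_mul_mS_le` / `yS_le_bS` (decision-tree Harris + vdBHK Thm 1.4), so that ONLY the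
finitary two-set input `hGP` for the hub weight remains as a hypothesis:
* `CovTau.a2Mix` — `E^mix_S(N)·Y^H(N') ≤ M_S(N ∪ N')·Y_{q^mix H}(N ∩ N')` in every world `G[U]`;
* `CovTau.p1Mix_univ` — its diagonal at `U = univ`, the finite-sum form of (Htw-mix) (memo Cor. 5.3): with `π` the law of `C_Y`,
  `E_π[1{x ∉ C_Y}·(q^mix(U∖C_Y) − p^mix)·H_{U∖C_Y}(v)] ≥ 0` written multiplicatively.
[cite: VandenbergHaggstromKahn2005, Thm. 1.1 (pp. 3–5), Thm. 1.4 (p. 7), Thm. 2.1 (p. 8)] [cite: Gladkov2024, Thm. 3.2 (p. 4)]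
[cite: KozmaNitzan2024, Question 9 (§5.5 p. 36)]
-/

noncomputable section

namespace Summit.CriticalPhenomena.PercolationContinuityZ3.Theorems.CovTau

open Literature.Probability.Percolation
open Literature.Probability.Percolation.BHK2006
open Literature.Probability.Percolation.DecisionTree (ind ind_of_mem ind_of_not_mem ind_nonneg)
open scoped Classical

variable {V : Type*} [Fintype V]

/-- **A2 with a hub, modulo the two-set input**: for a marker set `S ∋ x` with `v ∉ S`, a hub set `Σ`, a monotone edge-cluster functional `g ≥ 0`,
`H_{G[U']}(v) = Cov_{G[U']}(g(C_x), 1{v ↔ S})`, and all `N, N' ⊆ U`: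
`E^mix_S(N)·Y^H(N') ≤ M_S(N ∪ N')·Y_{q^mix H}(N ∩ N')`.
[cite: VandenbergHaggstromKahn2005, Thm. 1.1 (pp. 3–5), Thm. 1.4 (p. 7), Thm. 2.1 (p. 8)] [cite: Gladkov2024, Thm. 3.2 (p. 4)] -/
theorem a2Mix (w : Sym2 V → ℝ) (hw0 : ∀ e, 0 ≤ w e) (hw1 : ∀ e, w e ≤ 1) (hm : ∑ ω, weight w ω = 1)
    {x v : V} {S : Set V} (hxS : x ∈ S) (hvS : v ∉ S) (Sig : Finset V) {g : Set (Sym2 V) → ℝ} (hg : Monotone g)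
    (hg0 : ∀ C, 0 ≤ g C) (U : Finset V)
    (hGP : ∀ U' ⊆ U, v ∈ U' → ∀ N : Set V, N ⊆ ↑U' →
      (∑ ω, weight w ω * (hubInd Sig v (rC U' v ω) * ind (rD U' v (S ∪ N)) ω * ind (avoidAll U' Sig S) ω)) *
        Mav w U' S v ∅ ≤ EavMix w U' S Sig v ∅ * Mav w U' S v N)
    {N N' : Set V} (hNU : N ⊆ ↑U) (hN'U : N' ⊆ ↑U) :
    EavMix w U S Sig v N * Yw w U x (fun U' => BfS w U' x S v g) N' ≤
      Mav w U S v (N ∪ N') *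
        Yw w U x (fun U' => EavMix w U' S Sig v ∅ / Mav w U' S v ∅ * BfS w U' x S v g) (N ∩ N') :=
  metaA2_mix_of_star w hw0 hw1 hm x v S Sig (F := fun U' => BfS w U' x S v g)
    (fun U' => BfS_nonneg hw0 hw1 hm U' x S v hg hg0) (fun _ hv => BfS_eq_zero_of_not_mem w x hv hvS g) U
    (fun U' _ N _ => CovTauStarN.yS_mul_mS_le w hw0 hw1 hxS hvS hg hg0 U' N)
    (fun U' _ _ _ hNN' hN'U' => Yw_antitone_of_le w hw0 hw1 hm x _ U'
      (fun U'' _ u => CovTauStarN.yS_le_bS w hw0 hw1 x hvS hg hg0 U'' {u}) hNN' hN'U')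
    hGP N N' hNU hN'U

/-- **(Htw-mix), finite-sum form on the whole graph** (`U = univ`, `N = N' = Y`): modulo the two-set input,
`E^mix_S(Y)·Y^H(Y) ≤ M_S(Y)·Y_{q^mix H}(Y)`. [cite: VandenbergHaggstromKahn2005, Thm. 1.1 (pp. 3–5), Thm. 2.1 (p. 8)] -/
theorem p1Mix_univ (w : Sym2 V → ℝ) (hw0 : ∀ e, 0 ≤ w e) (hw1 : ∀ e, w e ≤ 1) (hm : ∑ ω, weight w ω = 1)
    {x v : V} {S : Set V} (hxS : x ∈ S) (hvS : v ∉ S) (Sig : Finset V) {g : Set (Sym2 V) → ℝ} (hg : Monotone g)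
    (hg0 : ∀ C, 0 ≤ g C)
    (hGP : ∀ U' : Finset V, v ∈ U' → ∀ N : Set V, N ⊆ ↑U' →
      (∑ ω, weight w ω * (hubInd Sig v (rC U' v ω) * ind (rD U' v (S ∪ N)) ω * ind (avoidAll U' Sig S) ω)) *
        Mav w U' S v ∅ ≤ EavMix w U' S Sig v ∅ * Mav w U' S v N)
    (Y : Set V) :
    EavMix w Finset.univ S Sig v Y * Yw w Finset.univ x (fun U' => BfS w U' x S v g) Y ≤
      Mav w Finset.univ S v Y *
        Yw w Finset.univ x (fun U' => EavMix w U' S Sig v ∅ / Mav w U' S v ∅ * BfS w U' x S v g) Y := by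
  have h := a2Mix w hw0 hw1 hm hxS hvS Sig hg hg0 Finset.univ (fun U' _ => hGP U') (N := Y) (N' := Y)
    (by simp) (by simp)
  simpa only [Set.union_self, Set.inter_self] using h

end Summit.CriticalPhenomena.PercolationContinuityZ3.Theorems.CovTau
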